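import Literature.NumberTheory.ConnesMoscovici2022.UVProlateSpectrum
import Literature.Analysis.ODE.LinearSecondOrder
import HarnessLib

/-!
# Connes–Moscovici 2022, Lemma 1.1 (deficiency indices `(4,4)`) — part A: classical solutions of
# `(p g′)′ = (q − z) g` on the three components of `ℝ ∖ {±λ}`

LINE 1 — FRAMING. RH-FREE corpus literature (spectral theory of the prolate wave operator
`W_λ = −∂(λ² − x²)∂ + (2πλx)²` on `L²(ℝ)`; sequel row of the Connes–Consani corpus, no leaf / binder
role).  bears_on: LADDER-RH W-C/W-P.  WHAT THIS IS NOT: any claim about RH; nothing in this file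
mentions `RiemannHypothesis` or bears on the truth of RH.

Theorems-only companion of `UVProlateSpectrum.lean` (statements AS PRINTED), first of the files
discharging the named fact `CM22_lemma_1_1` (**Lemma 1.1** of A. Connes, H. Moscovici, *The UV prolate
spectrum matches the zeros of zeta*, PNAS 119 (2022) [bib: `ConnesMoscovici2022`] = arXiv:2112.05500
Lemma 2.1, chunk p0004:L39–L48):

> "The deficiency indices of `W_min` are `(4,4)`."  Proof (printed): "Any `ξ ∈ Dom(W_max)` satisfying
> `Wξ = ±iξ` is a piecewise real analytic function and is uniquely specified by six parameters in the
> complement of the two regular singular points `±λ`. The known form of the solutions … together with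
> the fact that `Wξ ∈ L²(ℝ)` imply that the logarithmic singularities of `ξ` on the left and the right
> of `±λ` have to match. This reduces the number of parameters to `4`. Conversely, since all `4`
> singular points are LC (limit circle case), any solution of `Wξ = ±iξ` belongs to `Dom(W_max)`."

THIS FILE = "uniquely specified by six parameters in the complement of the two regular singular
points": the classical equation `(p g′)′ = (q − z) g` (`p = λ² − x²`, `q = (2πλx)²`, `z ∈ ℂ`
arbitrary — the count does not depend on `z = ±i`) on each of `(−∞, −λ)`, `(−λ, λ)`, `(λ, ∞)`,
phrased throughout by the two pointwise hypotheses
`∀ x ∈ J, HasDerivAt g (g′ x) x` and `∀ x ∈ J, HasDerivAt (p · g′) ((q x − z) g x) x`: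

* §1 dictionary with the tree's scalar linear theory `u″ = P u′ + Q u`
  (`Literature.Analysis.ODE.LinearSecondOrder`, `𝕜 = ℂ`): `P = 2x/p`, `Q = (q − z)/p` off `±λ`;
* §2 EXISTENCE with prescribed `(g, p g′)` at an interior point: on `(λ, ∞)`
  (`exists_solution_Ioi`), on `(−∞, −λ)` (reflection `x ↦ −x`, the equation is even), and on
  `(−λ, λ)` through a general exhaustion lemma for `u″ = P u′ + Q u` on a bounded open interval with
  coefficients continuous on the OPEN interval only (`exists_solution_Ioo`; the tree had the half-line
  and the compact-interval versions);
* §3 UNIQUENESS from the data `(g(x₀), (p g′)(x₀))` and smoothness off `±λ`;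
* §4 linear structure and the constancy of the Wronskian `p (g h′ − h g′)` (Abel) on each component.

0 `def`s, 0 new facts, no `sorry`.  The `L²`/endpoint analysis, the weak formulation and the count are
in the sibling files `UVProlateDeficiencyEndpoints/Weak/Indices`.
-/

noncomputable section

open Complex Set MeasureTheory Filter
open scoped Real Topology ContDiff

namespace Literature.NumberTheory.ConnesMoscovici2022

open Literature.NumberTheory.ConnesConsani2021 Literature.NumberTheory.ConnesConsani2024

/-! ## §0 The coefficients `p`, `q` and the open set `ℝ ∖ {±λ}` -/

/-- `p = λ² − x²` has derivative `−2x`. [cite: ConnesMoscovici2022, §1 eq. (1.1) (= arXiv (2.1), chunk p0004:L5–L9)] -/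
theorem hasDerivAt_pCoeff_def (lam x : ℝ) : HasDerivAt (pCoeff lam) (((-(2 * x) : ℝ)) : ℂ) x := by
  unfold pCoeff
  have h := (((hasDerivAt_const x (lam ^ 2)).sub (hasDerivAt_pow 2 x))).ofReal_comp
  refine h.congr_deriv ?_
  push_cast; ring

/-- `p` is smooth. [cite: ConnesMoscovici2022, §1 eq. (1.1) (= arXiv (2.1), chunk p0004:L5–L9)] -/
theorem contDiff_pCoeff_def (lam : ℝ) (n : WithTop ℕ∞) : ContDiff ℝ n (pCoeff lam) := by
  have h : ContDiff ℝ n (fun x : ℝ ↦ lam ^ 2 - x ^ 2) := by fun_prop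
  exact Complex.ofRealCLM.contDiff.comp h

/-- `q` is smooth. [cite: ConnesMoscovici2022, §1 eq. (1.1) (= arXiv (2.1), chunk p0004:L5–L9)] -/
theorem contDiff_qCoeff_def (lam : ℝ) (n : WithTop ℕ∞) : ContDiff ℝ n (qCoeff lam) := by
  have h : ContDiff ℝ n (fun x : ℝ ↦ (2 * π * lam) ^ 2 * x ^ 2) := by fun_prop
  exact Complex.ofRealCLM.contDiff.comp h

/-- `p` is continuous. [cite: ConnesMoscovici2022, §1 eq. (1.1) (= arXiv (2.1), chunk p0004:L5–L9)] -/
theorem continuous_pCoeff_def (lam : ℝ) : Continuous (pCoeff lam) :=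
  (contDiff_pCoeff_def lam 0).continuous

/-- `q` is continuous. [cite: ConnesMoscovici2022, §1 eq. (1.1) (= arXiv (2.1), chunk p0004:L5–L9)] -/
theorem continuous_qCoeff_def (lam : ℝ) : Continuous (qCoeff lam) :=
  (contDiff_qCoeff_def lam 0).continuous

/-- `p(x) ≠ 0` iff `x ≠ ±λ` (the two regular singular points). [cite: ConnesMoscovici2022, Lemma 1.1 proof, "the complement of the two regular singular points ±λ" (= arXiv Lemma 2.1, chunk p0004:L41–L44)] -/
theorem pCoeff_ne_zero_iff {lam x : ℝ} : pCoeff lam x ≠ 0 ↔ x ≠ lam ∧ x ≠ -lam := by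
  unfold pCoeff
  rw [Complex.ofReal_ne_zero, show lam ^ 2 - x ^ 2 = (lam - x) * (lam + x) by ring, mul_ne_zero_iff,
    sub_ne_zero, ne_comm (a := lam)]
  constructor
  · rintro ⟨h1, h2⟩; exact ⟨h1, fun h ↦ h2 (by rw [h]; ring)⟩
  · rintro ⟨h1, h2⟩; exact ⟨h1, fun h ↦ h2 (by linarith)⟩

/-- The open set `U = ℝ ∖ {±λ}`. [cite: ConnesMoscovici2022, Lemma 1.1 proof, "the complement of the two regular singular points ±λ" (= arXiv Lemma 2.1, chunk p0004:L41–L44)] -/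
theorem isOpen_setOf_ne_ne (lam : ℝ) : IsOpen {x : ℝ | x ≠ lam ∧ x ≠ -lam} :=
  isOpen_ne.and isOpen_ne

/-- `(λ, ∞) ⊆ ℝ ∖ {±λ}` for `λ > 0`. [cite: ConnesMoscovici2022, Lemma 1.1 proof, "the complement of the two regular singular points ±λ" (= arXiv Lemma 2.1, chunk p0004:L41–L44)] -/
theorem Ioi_subset_setOf_ne_ne {lam : ℝ} (hlam : 0 < lam) :
    Ioi lam ⊆ {x : ℝ | x ≠ lam ∧ x ≠ -lam} := fun x hx ↦
  ⟨ne_of_gt hx, by intro h; rw [h] at hx; exact absurd hx (by simp; linarith)⟩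

/-- `(−∞, −λ) ⊆ ℝ ∖ {±λ}` for `λ > 0`. [cite: ConnesMoscovici2022, Lemma 1.1 proof, "the complement of the two regular singular points ±λ" (= arXiv Lemma 2.1, chunk p0004:L41–L44)] -/
theorem Iio_subset_setOf_ne_ne {lam : ℝ} (hlam : 0 < lam) :
    Iio (-lam) ⊆ {x : ℝ | x ≠ lam ∧ x ≠ -lam} := fun x hx ↦
  ⟨by intro h; rw [h] at hx; exact absurd hx (by simp; linarith), ne_of_lt hx⟩

/-- `(−λ, λ) ⊆ ℝ ∖ {±λ}`. [cite: ConnesMoscovici2022, Lemma 1.1 proof, "the complement of the two regular singular points ±λ" (= arXiv Lemma 2.1, chunk p0004:L41–L44)] -/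
theorem Ioo_subset_setOf_ne_ne (lam : ℝ) :
    Ioo (-lam) lam ⊆ {x : ℝ | x ≠ lam ∧ x ≠ -lam} := fun _ hx ↦ ⟨ne_of_lt hx.2, ne_of_gt hx.1⟩

/-! ## §1 Dictionary with `u″ = P u′ + Q u`, `P = 2x/p`, `Q = (q − z)/p` -/

section Dictionary

variable (lam : ℝ) (z : ℂ)

/-- `P = 2x/p` is smooth off `±λ`. [cite: ConnesMoscovici2022, Lemma 1.1 proof, "the complement of the two regular singular points ±λ" (= arXiv Lemma 2.1, chunk p0004:L41–L44)] -/
theorem contDiffOn_coeffP :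
    ContDiffOn ℝ ∞ (fun x : ℝ ↦ ((2 * x : ℝ) : ℂ) / pCoeff lam x) {x : ℝ | x ≠ lam ∧ x ≠ -lam} := by
  have h1 : ContDiff ℝ ∞ (fun x : ℝ ↦ ((2 * x : ℝ) : ℂ)) :=
    Complex.ofRealCLM.contDiff.comp (by fun_prop : ContDiff ℝ ∞ fun x : ℝ ↦ (2 * x : ℝ))
  have h2 : ContDiffOn ℝ ∞ (fun x ↦ (pCoeff lam x)⁻¹) {x : ℝ | x ≠ lam ∧ x ≠ -lam} :=
    (contDiff_pCoeff_def lam _).contDiffOn.inv fun x hx ↦ pCoeff_ne_zero_iff.2 hx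
  simp_rw [div_eq_mul_inv]
  exact h1.contDiffOn.mul h2

/-- `Q = (q − z)/p` is smooth off `±λ`. [cite: ConnesMoscovici2022, Lemma 1.1 proof, "the complement of the two regular singular points ±λ" (= arXiv Lemma 2.1, chunk p0004:L41–L44)] -/
theorem contDiffOn_coeffQ :
    ContDiffOn ℝ ∞ (fun x : ℝ ↦ (qCoeff lam x - z) / pCoeff lam x) {x : ℝ | x ≠ lam ∧ x ≠ -lam} := by
  have h1 : ContDiff ℝ ∞ (fun x : ℝ ↦ qCoeff lam x - z) := (contDiff_qCoeff_def lam _).sub contDiff_const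
  have h2 : ContDiffOn ℝ ∞ (fun x ↦ (pCoeff lam x)⁻¹) {x : ℝ | x ≠ lam ∧ x ≠ -lam} :=
    (contDiff_pCoeff_def lam _).contDiffOn.inv fun x hx ↦ pCoeff_ne_zero_iff.2 hx
  simp_rw [div_eq_mul_inv]
  exact h1.contDiffOn.mul h2

/-- `P` is continuous on any set avoiding `±λ`. [cite: ConnesMoscovici2022, Lemma 1.1 proof, "the complement of the two regular singular points ±λ" (= arXiv Lemma 2.1, chunk p0004:L41–L44)] -/
theorem continuousOn_coeffP {s : Set ℝ} (hs : s ⊆ {x : ℝ | x ≠ lam ∧ x ≠ -lam}) :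
    ContinuousOn (fun x : ℝ ↦ ((2 * x : ℝ) : ℂ) / pCoeff lam x) s :=
  ((contDiffOn_coeffP lam).continuousOn).mono hs

/-- `Q` is continuous on any set avoiding `±λ`. [cite: ConnesMoscovici2022, Lemma 1.1 proof, "the complement of the two regular singular points ±λ" (= arXiv Lemma 2.1, chunk p0004:L41–L44)] -/
theorem continuousOn_coeffQ {s : Set ℝ} (hs : s ⊆ {x : ℝ | x ≠ lam ∧ x ≠ -lam}) :
    ContinuousOn (fun x : ℝ ↦ (qCoeff lam x - z) / pCoeff lam x) s :=
  ((contDiffOn_coeffQ lam z).continuousOn).mono hs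

variable {lam z}

/-- **From `u″ = P u′ + Q u` to `(p u′)′ = (q − z) u`** at a point where `p ≠ 0`.
[cite: ConnesMoscovici2022, Lemma 1.1 proof (= arXiv Lemma 2.1, chunk p0004:L41–L44)] -/
theorem hasDerivAt_pMul_of_lin {u u' : ℝ → ℂ} {x : ℝ} (hx : x ≠ lam ∧ x ≠ -lam)
    (h2 : HasDerivAt u' (((2 * x : ℝ) : ℂ) / pCoeff lam x * u' x +
      (qCoeff lam x - z) / pCoeff lam x * u x) x) :
    HasDerivAt (fun y ↦ pCoeff lam y * u' y) ((qCoeff lam x - z) * u x) x := by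
  have hp := pCoeff_ne_zero_iff.2 hx
  have h := (hasDerivAt_pCoeff_def lam x).mul h2
  refine h.congr_deriv ?_
  field_simp
  push_cast
  ring

/-- **From `(p g′)′ = (q − z) g` to `g″ = P g′ + Q g`** at a point where `p ≠ 0`: `g′ = (p g′)/p`
near the point, so `g′` is differentiable there with the displayed derivative.
[cite: ConnesMoscovici2022, Lemma 1.1 proof (= arXiv Lemma 2.1, chunk p0004:L41–L44)] -/
theorem hasDerivAt_lin_of_pMul {g g' : ℝ → ℂ} {x : ℝ} (hx : x ≠ lam ∧ x ≠ -lam)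
    (h2 : HasDerivAt (fun y ↦ pCoeff lam y * g' y) ((qCoeff lam x - z) * g x) x) :
    HasDerivAt g' (((2 * x : ℝ) : ℂ) / pCoeff lam x * g' x +
      (qCoeff lam x - z) / pCoeff lam x * g x) x := by
  have hp := pCoeff_ne_zero_iff.2 hx
  -- `g′ = (p g′)/p` on a neighbourhood of `x`
  have hev : ∀ᶠ y in 𝓝 x, pCoeff lam y ≠ 0 :=
    (continuous_pCoeff_def lam).continuousAt.eventually_ne hp
  have heq : (fun y ↦ pCoeff lam y * g' y / pCoeff lam y) =ᶠ[𝓝 x] g' := by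
    filter_upwards [hev] with y hy
    field_simp
  have h := (h2.div (hasDerivAt_pCoeff_def lam x) hp).congr_of_eventuallyEq heq.symm
  refine h.congr_deriv ?_
  field_simp
  push_cast
  ring

/-- A solution pair of `(p g′)′ = (q − z) g` on a set avoiding `±λ` is a solution pair of
`u″ = P u′ + Q u` there. [cite: ConnesMoscovici2022, Lemma 1.1 proof (= arXiv Lemma 2.1, chunk p0004:L41–L44)] -/
theorem lin_of_pMul {s : Set ℝ} (hs : s ⊆ {x : ℝ | x ≠ lam ∧ x ≠ -lam}) {g g' : ℝ → ℂ}
    (hg : ∀ x ∈ s, HasDerivAt g (g' x) x)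
    (hu : ∀ x ∈ s, HasDerivAt (fun y ↦ pCoeff lam y * g' y) ((qCoeff lam x - z) * g x) x) :
    ∀ x ∈ s, HasDerivAt g (g' x) x ∧ HasDerivAt g' (((2 * x : ℝ) : ℂ) / pCoeff lam x * g' x +
      (qCoeff lam x - z) / pCoeff lam x * g x) x :=
  fun x hx ↦ ⟨hg x hx, hasDerivAt_lin_of_pMul (hs hx) (hu x hx)⟩

/-- A solution pair of `u″ = P u′ + Q u` on a set avoiding `±λ` is a solution pair of
`(p g′)′ = (q − z) g` there. [cite: ConnesMoscovici2022, Lemma 1.1 proof (= arXiv Lemma 2.1, chunk p0004:L41–L44)] -/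
theorem pMul_of_lin {s : Set ℝ} (hs : s ⊆ {x : ℝ | x ≠ lam ∧ x ≠ -lam}) {u u' : ℝ → ℂ}
    (h : ∀ x ∈ s, HasDerivAt u (u' x) x ∧ HasDerivAt u' (((2 * x : ℝ) : ℂ) / pCoeff lam x * u' x +
      (qCoeff lam x - z) / pCoeff lam x * u x) x) :
    ∀ x ∈ s, HasDerivAt (fun y ↦ pCoeff lam y * u' y) ((qCoeff lam x - z) * u x) x :=
  fun x hx ↦ hasDerivAt_pMul_of_lin (hs hx) (h x hx).2

end Dictionary

/-! ## §2a A general exhaustion lemma: `u″ = P u′ + Q u` on a bounded open interval -/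

/-- **Global solutions of `u″ = P u′ + Q u` on an open interval with coefficients continuous on the
open interval only** (they may blow up at the ends): prescribed data at `t₀ ∈ (a, b)` are carried by
a solution pair on all of `(a, b)`.  Proof: solve on the compact exhaustion
`[aₙ, bₙ] = [a + (t₀ − a)/(n+2), b − (b − t₀)/(n+2)]` with clamped (hence globally continuous)
coefficients (`exists_solution_Ioi` of the tree), and patch the solutions together by uniqueness
(`eqOn_of_solution_Ioo`). [cite: Hartman2002, Ch. IV Lemma 1.1] -/
theorem exists_solution_Ioo {P Q : ℝ → ℂ} {a b t₀ : ℝ} (hP : ContinuousOn P (Ioo a b))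
    (hQ : ContinuousOn Q (Ioo a b)) (ht₀ : t₀ ∈ Ioo a b) (c₀ c₁ : ℂ) :
    ∃ u u' : ℝ → ℂ, u t₀ = c₀ ∧ u' t₀ = c₁ ∧ ∀ t ∈ Ioo a b,
      HasDerivAt u (u' t) t ∧ HasDerivAt u' (P t * u' t + Q t * u t) t := by
  -- the exhaustion
  set an : ℕ → ℝ := fun n ↦ a + (t₀ - a) / (n + 2) with han
  set bn : ℕ → ℝ := fun n ↦ b - (b - t₀) / (n + 2) with hbn
  have hta : 0 < t₀ - a := sub_pos.2 ht₀.1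
  have htb : 0 < b - t₀ := sub_pos.2 ht₀.2
  have han_gt : ∀ n, a < an n := fun n ↦ by
    simp only [han]; have : (0:ℝ) < (t₀ - a) / (n + 2) := by positivity
    linarith
  have hbn_lt : ∀ n, bn n < b := fun n ↦ by
    simp only [hbn]; have : (0:ℝ) < (b - t₀) / (n + 2) := by positivity
    linarith
  have han_lt : ∀ n, an n < t₀ := fun n ↦ by
    simp only [han]
    have h2 : (1:ℝ) < (n:ℝ) + 2 := by have := n.cast_nonneg (α := ℝ); linarith
    have : (t₀ - a) / (n + 2) < t₀ - a := div_lt_self hta h2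
    linarith
  have hbn_gt : ∀ n, t₀ < bn n := fun n ↦ by
    simp only [hbn]
    have h2 : (1:ℝ) < (n:ℝ) + 2 := by have := n.cast_nonneg (α := ℝ); linarith
    have : (b - t₀) / (n + 2) < b - t₀ := div_lt_self htb h2
    linarith
  have hmono_a : ∀ {m n : ℕ}, m ≤ n → an n ≤ an m := fun {m n} hmn ↦ by
    simp only [han]
    have : (t₀ - a) / (n + 2) ≤ (t₀ - a) / (m + 2) :=
      div_le_div_of_nonneg_left hta.le (by positivity) (by exact_mod_cast Nat.add_le_add_right hmn 2)
    linarith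
  have hmono_b : ∀ {m n : ℕ}, m ≤ n → bn m ≤ bn n := fun {m n} hmn ↦ by
    simp only [hbn]
    have : (b - t₀) / (n + 2) ≤ (b - t₀) / (m + 2) :=
      div_le_div_of_nonneg_left htb.le (by positivity) (by exact_mod_cast Nat.add_le_add_right hmn 2)
    linarith
  have hsub : ∀ n, Icc (an n) (bn n) ⊆ Ioo a b := fun n x hx ↦
    ⟨(han_gt n).trans_le hx.1, hx.2.trans_lt (hbn_lt n)⟩
  -- every point of `(a, b)` lies in some `(aₙ, bₙ)`
  have hcover : ∀ t ∈ Ioo a b, ∃ n : ℕ, t ∈ Ioo (an n) (bn n) := by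
    intro t ht
    obtain ⟨n, hn⟩ := exists_nat_gt (max ((t₀ - a) / (t - a)) ((b - t₀) / (b - t)))
    have hta' : 0 < t - a := sub_pos.2 ht.1
    have htb' : 0 < b - t := sub_pos.2 ht.2
    have hn2 : (0:ℝ) < n + 2 := by positivity
    refine ⟨n, ?_, ?_⟩
    · simp only [han]
      have h1 : (t₀ - a) / (t - a) < n + 2 := by linarith [le_max_left ((t₀ - a) / (t - a)) ((b - t₀) / (b - t))]
      have h2 : (t₀ - a) / (n + 2) < t - a := by
        rw [div_lt_iff₀ hn2]; rw [div_lt_iff₀ hta'] at h1; linarith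
      linarith
    · simp only [hbn]
      have h1 : (b - t₀) / (b - t) < n + 2 := by linarith [le_max_right ((t₀ - a) / (t - a)) ((b - t₀) / (b - t))]
      have h2 : (b - t₀) / (n + 2) < b - t := by
        rw [div_lt_iff₀ hn2]; rw [div_lt_iff₀ htb'] at h1; linarith
      linarith
  -- clamped coefficients and the solutions on each `(aₙ, bₙ)`
  have hclamp : ∀ n, ∃ u u' : ℝ → ℂ, u t₀ = c₀ ∧ u' t₀ = c₁ ∧ ∀ t ∈ Ioo (an n) (bn n),
      HasDerivAt u (u' t) t ∧ HasDerivAt u' (P t * u' t + Q t * u t) t := by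
    intro n
    have hle : an n ≤ bn n := ((han_lt n).trans (hbn_gt n)).le
    set Pc : ℝ → ℂ := fun t ↦ P (projIcc (an n) (bn n) hle t) with hPc
    set Qc : ℝ → ℂ := fun t ↦ Q (projIcc (an n) (bn n) hle t) with hQc
    have hPcc : Continuous Pc := (hP.mono (hsub n)).comp_continuous
      (continuous_subtype_val.comp continuous_projIcc) fun t ↦ (projIcc _ _ hle t).2
    have hQcc : Continuous Qc := (hQ.mono (hsub n)).comp_continuous
      (continuous_subtype_val.comp continuous_projIcc) fun t ↦ (projIcc _ _ hle t).2
    obtain ⟨u, u', hu0, hu1, hsol⟩ := Literature.Analysis.ODE.exists_solution_Ioi (p := Pc) (q := Qc)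
      (r₀ := an n - 1) hPcc.continuousOn hQcc.continuousOn t₀ c₀ c₁
    refine ⟨u, u', hu0, hu1, fun t ht ↦ ?_⟩
    have ht' : t ∈ Ioi (an n - 1) := by simp only [mem_Ioi]; linarith [ht.1]
    have hproj : (projIcc (an n) (bn n) hle t : ℝ) = t := by
      rw [projIcc_of_mem hle (Ioo_subset_Icc_self ht)]
    have h := hsol t ht'
    simp only [hPc, hQc, hproj] at h
    exact h
  choose U U' hU0 hU1 hUsol using hclamp
  -- consistency between the levels
  have hcons : ∀ {m n : ℕ}, m ≤ n → EqOn (U m) (U n) (Ioo (an m) (bn m)) ∧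
      EqOn (U' m) (U' n) (Ioo (an m) (bn m)) := by
    intro m n hmn
    have hsub' : Ioo (an m) (bn m) ⊆ Ioo (an n) (bn n) :=
      Ioo_subset_Ioo (hmono_a hmn) (hmono_b hmn)
    exact Literature.Analysis.ODE.eqOn_of_solution_Ioo
      (hP.mono ((Ioo_subset_Icc_self).trans (hsub m))) (hQ.mono ((Ioo_subset_Icc_self).trans (hsub m)))
      ⟨han_lt m, hbn_gt m⟩ (hUsol m) (fun t ht ↦ hUsol n t (hsub' ht))
      (by rw [hU0, hU0]) (by rw [hU1, hU1])
  -- the patched solution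
  classical
  set N : ℝ → ℕ := fun t ↦ if h : t ∈ Ioo a b then Classical.choose (hcover t h) else 0 with hN
  have hNspec : ∀ t (h : t ∈ Ioo a b), t ∈ Ioo (an (N t)) (bn (N t)) := by
    intro t h
    have : N t = Classical.choose (hcover t h) := by simp only [hN, dif_pos h]
    rw [this]; exact Classical.choose_spec (hcover t h)
  refine ⟨fun t ↦ U (N t) t, fun t ↦ U' (N t) t, hU0 _, hU1 _, fun t ht ↦ ?_⟩
  -- near `t`, the patched functions agree with level `N t`
  have hmem := hNspec t ht
  have hagree : ∀ s ∈ Ioo (an (N t)) (bn (N t)),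
      U (N s) s = U (N t) s ∧ U' (N s) s = U' (N t) s := by
    intro s hs
    have hs' : s ∈ Ioo a b := (Ioo_subset_Icc_self.trans (hsub _)) hs
    have hsm := hNspec s hs'
    rcases le_total (N s) (N t) with hle | hle
    · exact ⟨(hcons hle).1 hsm, (hcons hle).2 hsm⟩
    · exact ⟨((hcons hle).1 hs).symm, ((hcons hle).2 hs).symm⟩
  have hev : ∀ᶠ s in 𝓝 t, s ∈ Ioo (an (N t)) (bn (N t)) := Ioo_mem_nhds hmem.1 hmem.2
  have hev1 : (fun s ↦ U (N s) s) =ᶠ[𝓝 t] U (N t) := by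
    filter_upwards [hev] with s hs using (hagree s hs).1
  have hev2 : (fun s ↦ U' (N s) s) =ᶠ[𝓝 t] U' (N t) := by
    filter_upwards [hev] with s hs using (hagree s hs).2
  obtain ⟨h1, h2⟩ := hUsol (N t) t hmem
  exact ⟨h1.congr_of_eventuallyEq hev1, h2.congr_of_eventuallyEq hev2⟩

/-! ## §2b Existence on the three components with prescribed `(g, p g′)` -/

section Existence

variable {lam : ℝ} (hlam : 0 < lam) (z : ℂ)
include hlam

/-- **Solutions on `(λ, ∞)` with prescribed data.** For `x₀ > λ` and `d₀, d₁ ∈ ℂ` there is a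
solution pair `(g, g′)` of `(p g′)′ = (q − z) g` on `(λ, ∞)` with `g x₀ = d₀`, `p(x₀) g′(x₀) = d₁`.
[cite: ConnesMoscovici2022, Lemma 1.1 proof (= arXiv Lemma 2.1, chunk p0004:L41–L44)] -/
theorem exists_sol_Ioi {x₀ : ℝ} (hx₀ : lam < x₀) (d₀ d₁ : ℂ) :
    ∃ g g' : ℝ → ℂ, g x₀ = d₀ ∧ pCoeff lam x₀ * g' x₀ = d₁ ∧ ∀ x ∈ Ioi lam,
      HasDerivAt g (g' x) x ∧
        HasDerivAt (fun y ↦ pCoeff lam y * g' y) ((qCoeff lam x - z) * g x) x := by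
  have hs := Ioi_subset_setOf_ne_ne hlam
  have hp0 : pCoeff lam x₀ ≠ 0 := pCoeff_ne_zero_iff.2 (hs hx₀)
  obtain ⟨u, u', hu0, hu1, hsol⟩ := Literature.Analysis.ODE.exists_solution_Ioi
    (continuousOn_coeffP lam hs) (continuousOn_coeffQ lam z hs) x₀ d₀ (d₁ / pCoeff lam x₀)
  refine ⟨u, u', hu0, by rw [hu1]; field_simp, fun x hx ↦ ⟨(hsol x hx).1, ?_⟩⟩
  exact pMul_of_lin hs hsol x hx

/-- **Solutions on `(−∞, −λ)` with prescribed data** (the equation is invariant under `x ↦ −x`: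
reflect a solution on `(λ, ∞)`). [cite: ConnesMoscovici2022, Lemma 1.1 proof (= arXiv Lemma 2.1, chunk p0004:L41–L44); §1 ¶1 "invariant under the parity exchange" (chunk p0004:L14)] -/
theorem exists_sol_Iio {x₀ : ℝ} (hx₀ : x₀ < -lam) (d₀ d₁ : ℂ) :
    ∃ g g' : ℝ → ℂ, g x₀ = d₀ ∧ pCoeff lam x₀ * g' x₀ = d₁ ∧ ∀ x ∈ Iio (-lam),
      HasDerivAt g (g' x) x ∧
        HasDerivAt (fun y ↦ pCoeff lam y * g' y) ((qCoeff lam x - z) * g x) x := by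
  have hx₀' : lam < -x₀ := by linarith
  obtain ⟨u, u', hu0, hu1, hsol⟩ := exists_sol_Ioi hlam z hx₀' d₀ (-d₁)
  have hpe : ∀ x, pCoeff lam (-x) = pCoeff lam x := fun x ↦ by simp [pCoeff]
  have hqe : ∀ x, qCoeff lam (-x) = qCoeff lam x := fun x ↦ by simp [qCoeff]
  refine ⟨fun x ↦ u (-x), fun x ↦ -u' (-x), by simpa using hu0, ?_, fun x hx ↦ ?_⟩
  · rw [← hpe x₀, mul_neg, hu1, neg_neg]
  have hx' : -x ∈ Ioi lam := by simp only [mem_Ioi]; linarith [mem_Iio.1 hx]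
  obtain ⟨h1, h2⟩ := hsol (-x) hx'
  have hn : HasDerivAt (fun y : ℝ ↦ -y) (-1 : ℝ) x := hasDerivAt_neg x
  constructor
  · have := h1.scomp x hn
    simpa [Function.comp_def] using this
  · have h2' := h2.scomp x hn
    have : (fun y ↦ pCoeff lam y * -u' (-y)) = fun y ↦ -((fun y ↦ pCoeff lam y * u' y) ∘ fun y ↦ -y) y := by
      funext y; simp [hpe]
    rw [this]
    refine (h2'.neg).congr_deriv ?_
    simp [hqe]

omit hlam in
/-- **Solutions on `(−λ, λ)` with prescribed data** (`exists_solution_Ioo`).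
[cite: ConnesMoscovici2022, Lemma 1.1 proof (= arXiv Lemma 2.1, chunk p0004:L41–L44)] -/
theorem exists_sol_Ioo {x₀ : ℝ} (hx₀ : x₀ ∈ Ioo (-lam) lam) (d₀ d₁ : ℂ) :
    ∃ g g' : ℝ → ℂ, g x₀ = d₀ ∧ pCoeff lam x₀ * g' x₀ = d₁ ∧ ∀ x ∈ Ioo (-lam) lam,
      HasDerivAt g (g' x) x ∧
        HasDerivAt (fun y ↦ pCoeff lam y * g' y) ((qCoeff lam x - z) * g x) x := by
  have hs := Ioo_subset_setOf_ne_ne lam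
  have hp0 : pCoeff lam x₀ ≠ 0 := pCoeff_ne_zero_iff.2 (hs hx₀)
  obtain ⟨u, u', hu0, hu1, hsol⟩ := exists_solution_Ioo
    (continuousOn_coeffP lam hs) (continuousOn_coeffQ lam z hs) hx₀ d₀ (d₁ / pCoeff lam x₀)
  refine ⟨u, u', hu0, by rw [hu1]; field_simp, fun x hx ↦ ⟨(hsol x hx).1, ?_⟩⟩
  exact pMul_of_lin hs hsol x hx

end Existence

/-! ## §3 Uniqueness from the data `(g(x₀), p(x₀) g′(x₀))`, and smoothness -/

section Uniqueness

variable {lam : ℝ} {z : ℂ}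

/-- **Uniqueness on an open interval avoiding `±λ`.** Two solution pairs of `(p g′)′ = (q − z) g` on
`(a, b) ⊆ ℝ ∖ {±λ}` with the same value and the same `p g′` at some `x₀ ∈ (a, b)` coincide on
`(a, b)` (together with their derivatives). [cite: ConnesMoscovici2022, Lemma 1.1 proof "uniquely specified by six parameters" (= arXiv Lemma 2.1, chunk p0004:L41–L44)] -/
theorem eqOn_of_sol_Ioo {a b x₀ : ℝ} (hs : Ioo a b ⊆ {x : ℝ | x ≠ lam ∧ x ≠ -lam})
    (hx₀ : x₀ ∈ Ioo a b) {g g' h h' : ℝ → ℂ}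
    (hg : ∀ x ∈ Ioo a b, HasDerivAt g (g' x) x)
    (hgu : ∀ x ∈ Ioo a b, HasDerivAt (fun y ↦ pCoeff lam y * g' y) ((qCoeff lam x - z) * g x) x)
    (hh : ∀ x ∈ Ioo a b, HasDerivAt h (h' x) x)
    (hhu : ∀ x ∈ Ioo a b, HasDerivAt (fun y ↦ pCoeff lam y * h' y) ((qCoeff lam x - z) * h x) x)
    (h0 : g x₀ = h x₀) (h1 : pCoeff lam x₀ * g' x₀ = pCoeff lam x₀ * h' x₀) :
    EqOn g h (Ioo a b) ∧ EqOn g' h' (Ioo a b) := by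
  have hp0 : pCoeff lam x₀ ≠ 0 := pCoeff_ne_zero_iff.2 (hs hx₀)
  have h1' : g' x₀ = h' x₀ := mul_left_cancel₀ hp0 h1
  exact Literature.Analysis.ODE.eqOn_of_solution_Ioo (continuousOn_coeffP lam hs)
    (continuousOn_coeffQ lam z hs) hx₀ (lin_of_pMul hs hg hgu) (lin_of_pMul hs hh hhu) h0 h1'

/-- Uniqueness on `(λ, ∞)`. [cite: ConnesMoscovici2022, Lemma 1.1 proof (= arXiv Lemma 2.1, chunk p0004:L41–L44)] -/
theorem eqOn_of_sol_Ioi (hlam : 0 < lam) {x₀ : ℝ} (hx₀ : lam < x₀) {g g' h h' : ℝ → ℂ}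
    (hg : ∀ x ∈ Ioi lam, HasDerivAt g (g' x) x)
    (hgu : ∀ x ∈ Ioi lam, HasDerivAt (fun y ↦ pCoeff lam y * g' y) ((qCoeff lam x - z) * g x) x)
    (hh : ∀ x ∈ Ioi lam, HasDerivAt h (h' x) x)
    (hhu : ∀ x ∈ Ioi lam, HasDerivAt (fun y ↦ pCoeff lam y * h' y) ((qCoeff lam x - z) * h x) x)
    (h0 : g x₀ = h x₀) (h1 : pCoeff lam x₀ * g' x₀ = pCoeff lam x₀ * h' x₀) :
    EqOn g h (Ioi lam) ∧ EqOn g' h' (Ioi lam) := by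
  have key : ∀ x ∈ Ioi lam, g x = h x ∧ g' x = h' x := by
    intro x hx
    set b : ℝ := max x x₀ + 1 with hb
    have hsub : Ioo lam b ⊆ Ioi lam := fun y hy ↦ hy.1
    have hs : Ioo lam b ⊆ {x : ℝ | x ≠ lam ∧ x ≠ -lam} := hsub.trans (Ioi_subset_setOf_ne_ne hlam)
    have hx₀' : x₀ ∈ Ioo lam b := ⟨hx₀, by rw [hb]; linarith [le_max_right x x₀]⟩
    have hx' : x ∈ Ioo lam b := ⟨hx, by rw [hb]; linarith [le_max_left x x₀]⟩
    have := eqOn_of_sol_Ioo hs hx₀' (fun y hy ↦ hg y (hsub hy)) (fun y hy ↦ hgu y (hsub hy))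
      (fun y hy ↦ hh y (hsub hy)) (fun y hy ↦ hhu y (hsub hy)) h0 h1
    exact ⟨this.1 hx', this.2 hx'⟩
  exact ⟨fun x hx ↦ (key x hx).1, fun x hx ↦ (key x hx).2⟩

/-- Uniqueness on `(−∞, −λ)`. [cite: ConnesMoscovici2022, Lemma 1.1 proof (= arXiv Lemma 2.1, chunk p0004:L41–L44)] -/
theorem eqOn_of_sol_Iio (hlam : 0 < lam) {x₀ : ℝ} (hx₀ : x₀ < -lam) {g g' h h' : ℝ → ℂ}
    (hg : ∀ x ∈ Iio (-lam), HasDerivAt g (g' x) x)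
    (hgu : ∀ x ∈ Iio (-lam), HasDerivAt (fun y ↦ pCoeff lam y * g' y) ((qCoeff lam x - z) * g x) x)
    (hh : ∀ x ∈ Iio (-lam), HasDerivAt h (h' x) x)
    (hhu : ∀ x ∈ Iio (-lam), HasDerivAt (fun y ↦ pCoeff lam y * h' y) ((qCoeff lam x - z) * h x) x)
    (h0 : g x₀ = h x₀) (h1 : pCoeff lam x₀ * g' x₀ = pCoeff lam x₀ * h' x₀) :
    EqOn g h (Iio (-lam)) ∧ EqOn g' h' (Iio (-lam)) := by
  have key : ∀ x ∈ Iio (-lam), g x = h x ∧ g' x = h' x := by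
    intro x hx
    set a : ℝ := min x x₀ - 1 with ha
    have hsub : Ioo a (-lam) ⊆ Iio (-lam) := fun y hy ↦ hy.2
    have hs : Ioo a (-lam) ⊆ {x : ℝ | x ≠ lam ∧ x ≠ -lam} := hsub.trans (Iio_subset_setOf_ne_ne hlam)
    have hx₀' : x₀ ∈ Ioo a (-lam) := ⟨by rw [ha]; linarith [min_le_right x x₀], hx₀⟩
    have hx' : x ∈ Ioo a (-lam) := ⟨by rw [ha]; linarith [min_le_left x x₀], hx⟩
    have := eqOn_of_sol_Ioo hs hx₀' (fun y hy ↦ hg y (hsub hy)) (fun y hy ↦ hgu y (hsub hy))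
      (fun y hy ↦ hh y (hsub hy)) (fun y hy ↦ hhu y (hsub hy)) h0 h1
    exact ⟨this.1 hx', this.2 hx'⟩
  exact ⟨fun x hx ↦ (key x hx).1, fun x hx ↦ (key x hx).2⟩

/-- **Smoothness off `±λ`.** A solution pair on an open set avoiding `±λ` is `C^∞` there, together
with `g′` ("piecewise real analytic" in print; `C^∞` is what is used).
[cite: ConnesMoscovici2022, Lemma 1.1 proof (= arXiv Lemma 2.1, chunk p0004:L41–L42)] -/
theorem contDiffOn_of_sol {U : Set ℝ} (hU : IsOpen U) (hs : U ⊆ {x : ℝ | x ≠ lam ∧ x ≠ -lam})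
    {g g' : ℝ → ℂ} (hg : ∀ x ∈ U, HasDerivAt g (g' x) x)
    (hgu : ∀ x ∈ U, HasDerivAt (fun y ↦ pCoeff lam y * g' y) ((qCoeff lam x - z) * g x) x) :
    ContDiffOn ℝ ∞ g U ∧ ContDiffOn ℝ ∞ g' U :=
  Literature.Analysis.ODE.contDiffOn_of_solution hU ((contDiffOn_coeffP lam).mono hs)
    ((contDiffOn_coeffQ lam z).mono hs) (lin_of_pMul hs hg hgu)

end Uniqueness

/-! ## §4 Linear structure and the Wronskian -/

section Linear

variable {lam : ℝ} {z : ℂ} {s : Set ℝ}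

/-- Linear combinations of solution pairs are solution pairs. [cite: ConnesMoscovici2022, Lemma 1.1 proof (= arXiv Lemma 2.1, chunk p0004:L41–L44)] -/
theorem sol_linear_comb {g₁ g₁' g₂ g₂' : ℝ → ℂ} (c₁ c₂ : ℂ)
    (hg₁ : ∀ x ∈ s, HasDerivAt g₁ (g₁' x) x)
    (hu₁ : ∀ x ∈ s, HasDerivAt (fun y ↦ pCoeff lam y * g₁' y) ((qCoeff lam x - z) * g₁ x) x)
    (hg₂ : ∀ x ∈ s, HasDerivAt g₂ (g₂' x) x)
    (hu₂ : ∀ x ∈ s, HasDerivAt (fun y ↦ pCoeff lam y * g₂' y) ((qCoeff lam x - z) * g₂ x) x) :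
    (∀ x ∈ s, HasDerivAt (fun y ↦ c₁ * g₁ y + c₂ * g₂ y) (c₁ * g₁' x + c₂ * g₂' x) x) ∧
      ∀ x ∈ s, HasDerivAt (fun y ↦ pCoeff lam y * (c₁ * g₁' y + c₂ * g₂' y))
        ((qCoeff lam x - z) * (c₁ * g₁ x + c₂ * g₂ x)) x := by
  refine ⟨fun x hx ↦ ((hg₁ x hx).const_mul c₁).add ((hg₂ x hx).const_mul c₂), fun x hx ↦ ?_⟩
  have h := ((hu₁ x hx).const_mul c₁).add ((hu₂ x hx).const_mul c₂)
  have heq : (fun y ↦ pCoeff lam y * (c₁ * g₁' y + c₂ * g₂' y)) =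
      fun y ↦ c₁ * (pCoeff lam y * g₁' y) + c₂ * (pCoeff lam y * g₂' y) := by
    funext y; ring
  rw [heq]
  exact h.congr_deriv (by ring)

/-- The zero pair is a solution pair. [cite: ConnesMoscovici2022, Lemma 1.1 proof, "the complement of the two regular singular points ±λ" (= arXiv Lemma 2.1, chunk p0004:L41–L44)] -/
theorem sol_zero :
    (∀ x ∈ s, HasDerivAt (fun _ : ℝ ↦ (0 : ℂ)) ((fun _ : ℝ ↦ (0 : ℂ)) x) x) ∧
      ∀ x ∈ s, HasDerivAt (fun y ↦ pCoeff lam y * (fun _ : ℝ ↦ (0 : ℂ)) y)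
        ((qCoeff lam x - z) * (fun _ : ℝ ↦ (0 : ℂ)) x) x := by
  refine ⟨fun x _ ↦ by simpa using hasDerivAt_const x (0 : ℂ), fun x _ ↦ ?_⟩
  simpa using hasDerivAt_const x (0 : ℂ)

/-- **Abel's identity**: along two solution pairs the Wronskian `g (p h′) − h (p g′)` has zero
derivative. [cite: ConnesMoscovici2022, §1 eqs. (1.5)–(1.6) (= arXiv (2.5)–(2.6), chunk p0005:L24–L31)] -/
theorem hasDerivAt_wronskian_sol {g g' h h' : ℝ → ℂ} {x : ℝ} (hx : x ∈ s)
    (hg : ∀ x ∈ s, HasDerivAt g (g' x) x)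
    (hgu : ∀ x ∈ s, HasDerivAt (fun y ↦ pCoeff lam y * g' y) ((qCoeff lam x - z) * g x) x)
    (hh : ∀ x ∈ s, HasDerivAt h (h' x) x)
    (hhu : ∀ x ∈ s, HasDerivAt (fun y ↦ pCoeff lam y * h' y) ((qCoeff lam x - z) * h x) x) :
    HasDerivAt (fun y ↦ g y * (pCoeff lam y * h' y) - h y * (pCoeff lam y * g' y)) 0 x := by
  have h1 := ((hg x hx).mul (hhu x hx)).sub ((hh x hx).mul (hgu x hx))
  refine h1.congr_deriv ?_
  ring

/-- **The Wronskian is constant on an open interval** carrying two solution pairs.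
[cite: ConnesMoscovici2022, §1 eqs. (1.5)–(1.6) (= arXiv (2.5)–(2.6), chunk p0005:L24–L31)] -/
theorem wronskian_sol_eq {a b : ℝ} {g g' h h' : ℝ → ℂ}
    (hg : ∀ x ∈ Ioo a b, HasDerivAt g (g' x) x)
    (hgu : ∀ x ∈ Ioo a b, HasDerivAt (fun y ↦ pCoeff lam y * g' y) ((qCoeff lam x - z) * g x) x)
    (hh : ∀ x ∈ Ioo a b, HasDerivAt h (h' x) x)
    (hhu : ∀ x ∈ Ioo a b, HasDerivAt (fun y ↦ pCoeff lam y * h' y) ((qCoeff lam x - z) * h x) x)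
    {x y : ℝ} (hx : x ∈ Ioo a b) (hy : y ∈ Ioo a b) :
    g x * (pCoeff lam x * h' x) - h x * (pCoeff lam x * g' x) =
      g y * (pCoeff lam y * h' y) - h y * (pCoeff lam y * g' y) := by
  have hd : ∀ t ∈ Ioo a b, HasDerivWithinAt
      (fun y ↦ g y * (pCoeff lam y * h' y) - h y * (pCoeff lam y * g' y)) 0 (Ioo a b) t :=
    fun t ht ↦ (hasDerivAt_wronskian_sol ht hg hgu hh hhu).hasDerivWithinAt
  exact (convex_Ioo a b).is_const_of_fderivWithin_eq_zero
    (fun t ht ↦ (hd t ht).differentiableWithinAt)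
    (fun t ht ↦ by
      have := (hd t ht).hasFDerivWithinAt
      rw [(hd t ht).hasFDerivWithinAt.fderivWithin (uniqueDiffOn_Ioo a b t ht)]
      ext; simp) hx hy

end Linear

end Literature.NumberTheory.ConnesMoscovici2022

end
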